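import Summits.BirchSwinnertonDyer.BirchSwinnertonDyer.Theorems.GenusKolyvaginAtTwoOffCutResidualAtTwoRLw2PhantomExclusionWitness
import Summits.BirchSwinnertonDyer.BirchSwinnertonDyer.Theorems.GenusKolyvaginAtTwoOffCutResidualAtTwoRLw2FlatQ3
import Summits.BirchSwinnertonDyer.BirchSwinnertonDyer.Theorems.GenusKolyvaginAtTwoOffCutResidualAtTwoRLw2FlatQ4
import Summits.BirchSwinnertonDyer.BirchSwinnertonDyer.Theses.GenusKolyvaginAtTwo
import HarnessLib

/-!
# Route `GenusKolyvaginAtTwo`, residual `OffCutResidualAtTwoR` (stmt-BirchSwinnertonDyer-31767), LINE 26 «lw2_phantom_exclusion»: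
# THE COMPOSITION GLUE — `OffCutResidualAtTwoR` BY NAME from the route's served items and the NEW, SMALLER residual R₂ (slice 1 ∧ ¬LW₂)

Width seat `bsd-line-gk2-p4` g31 (cell `bsd-f1-sign2`), `--supports stmt-BirchSwinnertonDyer-31767 --as helper`.  THEOREMS ONLY (no
definition, no named fact, no `sorry`).  **BSD is NOT proved by this file; `OffCutResidualAtTwoR` is NOT closed by it (it is reduced to R₂).**

WHAT.  LINE 26's skeleton `Cruxes/OffCutResidualAtTwoR/Lines/lw2_phantom_exclusion.lean` (pen bsd-idea-1 g24/g25, critic #471 PASS) composes the crux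
from five stubs and eleven served route items.  Four of the five stubs are now TREE THEOREMS — `stub_transport` = `levelTwoWitness_baseChange_of_rat`
(this seat, p781093), `stub_KLW` = `nonPhantom_baseChange_of_levelTwoWitness` (this seat, p780467), `stub_Q3flat` = `q3flat`, `stub_Q4flat` = `q4flat`
(gk2-p5 g40, `…Lw2FlatQ3` / `…Lw2FlatQ4`: the landed Q3R_T / Q4_T″ cones re-threaded with `(NPh at 2N)`); the fifth, `stub_residual`, is the line's
DECLARED residual R₂ = «slice 1 ∧ ¬LW₂(W)» ∨ slice 2 ∨ slice 3 (58 → 34 cells below `5·10⁵`).  This file is the skeleton's composition with the four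
stubs plugged BY NAME and R₂ carried as the ONLY extra hypothesis:
* ★ `offCutResidualAtTwoR_of_items_of_lw2Residual` — `GenusPrimitiveSupplyAtTwoPosDiscShallow → GenusDeepSupplyAtTwoNegDiscNarrow →
  CyclicTorsionOfNegDisc → KolyvaginRelationAtTwo → EquivariantChebotarevAtTwoR → ExactDescentAtTwoOfFourFacts → MinimalTwinBSDTwo → EntireLFunctionRat
  → GrossZagierAllLevels → MultPublishedInputsAtTwo → MilneAnyModel → R₂ → OffCutResidualAtTwoR` — the kernel-checked item-form reduction «31767 ⟸ served
  items + R₂» (same shape as the K-glue items' `…_of_items_of_selmerSplit_mixed`), i.e. the object a restate `OffCutResidualAtTwoR → R₂` of `closes` would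
  cite.  The engine branch: a place `v ∋ N` of `ℚ` witnessing the level-2 Lawson–Wuthrich class ⟹ (Heegner transport) a witness place `w₀ ∋ 2N` of `K`
  ⟹ (lever) `(NPh_M)` at every level ⟹ the flat exactness `#Ш(E/K)[2^∞] = 4^(M₀)` ⟹ (`ExactDescentAtTwo` + `MinimalTwinBSDTwo` of the twin) `BSD₂(E)`.
No new mathematics: the proof text is the skeleton's, verbatim up to the four names.  BSD is NOT proved by any of this.

References: [LawsonWuthrich2016] §4, §7.1, §8; [GrossLMS1991] §9; [Kolyvagin1989Izv] Thm. B₂; [Kramer1981] Thm. 1.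
-/

open scoped Classical NumberField

-- the Theorems namespace of this sub repeats the summit name by design (D-0017 nested layout)
set_option linter.dupNamespace false

namespace Summit.BirchSwinnertonDyer.BirchSwinnertonDyer.Theorems.GenusExact.Lw2PhantomExclusion

open WeierstrassCurve NumberField IsDedekindDomain Literature.NumberTheory.EllipticCurves
  Literature.NumberTheory.EllipticCurves.ModularForms
open Summit.BirchSwinnertonDyer.BirchSwinnertonDyer.Theses.GenusKolyvaginAtTwo

/-- ★ **LINE 26 COMPOSITION GLUE: `OffCutResidualAtTwoR` from the route's served items and the NEW residual R₂.**  The eleven antecedents before R₂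
are route items of `GenusKolyvaginAtTwo` (all binders of `closes` except the two Q1/Q5R items, closed); R₂ is `stub_residual` of LINE 26 VERBATIM
(slice 1 shrunk by `¬LW₂(W)`, slices 2–3 verbatim).  On slice 1 with an LW₂ witness the engine of `closes` runs with the odd multiplicative place replaced
by the level-2 witness: `levelTwoWitness_baseChange_of_rat` (transport), `nonPhantom_baseChange_of_levelTwoWitness` (lever), `q3flat` (Δ<0) /
`q4flat` (Δ>0) (flat exactness), then `ExactDescentAtTwo` with the twin's `BSD₂` from `MinimalTwinBSDTwo`.  Kernel-checked; no `sorry`; the crux is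
NOT closed (R₂ is a hypothesis).  BSD is NOT proved by this. [cite: LawsonWuthrich2016, §4, §7.1 and §8] [cite: GrossLMS1991, §9] -/
theorem offCutResidualAtTwoR_of_items_of_lw2Residual (hP : GenusPrimitiveSupplyAtTwoPosDiscShallow) (hPG : GenusDeepSupplyAtTwoNegDiscNarrow)
    (hQ1 : CyclicTorsionOfNegDisc) (hQ2 : KolyvaginRelationAtTwo) (hQ5R : EquivariantChebotarevAtTwoR)
    (hGf : ExactDescentAtTwoOfFourFacts) (hTw : MinimalTwinBSDTwo) (hL : EntireLFunctionRat) (hGZ : GrossZagierAllLevels)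
    (hGZK : MultPublishedInputsAtTwo) (hMi : MilneAnyModel)
    (hres :
      ∀ (W : WeierstrassCurve ℚ) [W.IsElliptic] [W.IsGloballyMinimal] [NeZero (W.conductorNorm ℤ)], ¬ W.HasCM → W.analyticRank = 0 → (∀ n : ℕ, 0 < n → W.HasSurjectiveModNGaloisRep ((2 : ℤ) ^ n)) → Odd W.tamagawaProduct → (∃ Dt : Literature.NumberTheory.EllipticCurves.ModularForms.ModularParametrizationData W (W.conductorNorm ℤ), (∀ z ∈ Dt.L.lattice, ∃ w ∈ Literature.NumberTheory.EllipticCurves.ModularForms.periodLattice Dt.f, z = (Dt.c : ℂ) * w) ∧ Odd Dt.c) → ((¬ (∃ v : IsDedekindDomain.HeightOneSpectrum (NumberField.RingOfIntegers ℚ), ((2 : ℕ) : NumberField.RingOfIntegers ℚ) ∉ v.asIdeal ∧ ((W.conductorNorm ℤ : ℕ) : NumberField.RingOfIntegers ℚ) ∈ v.asIdeal ∧ W.HasMultiplicativeReductionAt v)) ∧ Nat.card (W.selmerGroup 2) ≠ 1 ∧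
      ¬ (∃ v : HeightOneSpectrum (𝓞 ℚ), ((W.conductorNorm ℤ : ℕ) : 𝓞 ℚ) ∈ v.asIdeal ∧
      (∀ z : galH1Torsion W 2, z ≠ 0 → (∀ ρ ∈ torsionFixing W 4, h1Eval W 2 z ρ = 0) →
      z ∉ selmerLocalKer W (v.adicCompletion ℚ) 2))) ∨ (W.Δ < 0 ∧ ¬ (Nat.card (W.selmerGroup 2) = 1 ∨ Nat.card (W.selmerGroup 2) = 4)) ∨ (0 < W.Δ ∧ ¬ (Nat.card (W.selmerGroup 2) = 1 ∨ (Nat.card (W.selmerGroup 2) = 4 ∧ ∃ c ∈ (W.kummerSelmerStructure ((2 : ℕ) : ℤ)).selmerGroup, Literature.NumberTheory.GaloisRepresentations.galoisCohomology.localization (W.torsionGaloisModule ((2 : ℕ) : ℤ)) (Sum.inl Rat.infinitePlace) 1 c ≠ 0))) → Literature.NumberTheory.EllipticCurves.BSDp W 2) :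
    OffCutResidualAtTwoR := by
  have hG : ExactDescentAtTwo := hGf ⟨hGZ, hGZK, hL, hMi⟩
  intro W _ _ _ hcm hr0 hρ hT hopt hslice
  by_cases hLW : (∃ v : HeightOneSpectrum (𝓞 ℚ), ((W.conductorNorm ℤ : ℕ) : 𝓞 ℚ) ∈ v.asIdeal ∧
      (∀ z : galH1Torsion W 2, z ≠ 0 → (∀ ρ ∈ torsionFixing W 4, h1Eval W 2 z ρ = 0) →
        z ∉ selmerLocalKer W (v.adicCompletion ℚ) 2))
  swap
  · refine hres W hcm hr0 hρ hT hopt ?_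
    rcases hslice with ⟨hmult, h1⟩ | h23
    · exact Or.inl ⟨hmult, h1, hLW⟩
    · exact Or.inr h23
  rcases hslice with ⟨hmult, h1⟩ | h23
  swap
  · exact hres W hcm hr0 hρ hT hopt (Or.inr h23)
  -- slice 1 with a level-2 witness: the engine of `closes`, the witness in place of the multiplicative prime
  have hw : ∀ Dt : ModularParametrizationData W (W.conductorNorm ℤ), W.rootNumber = 1 := fun Dt ↦
    (Literature.Barriers.BirchSwinnertonDyer.even_analyticRank_iff_of_isNewformOf_conductorLevel Dt.isNewformOf).mp
      (by rw [hr0]; exact Even.zero)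
  rcases lt_or_gt_of_ne W.isUnit_Δ.ne_zero with hneg | hpos
  · by_cases h14 : Nat.card (W.selmerGroup 2) = 1 ∨ Nat.card (W.selmerGroup 2) = 4
    · obtain ⟨K, _, _, hIQ, hodd, h3, hHe, hsq1, hsq2, Dt, β, ι, d₁, hoptDt, hc, hy, M₀, hdiv, hndiv,
        n, d, hn, hKoly, hPn, Wd, _, _, hWd, hcmd, hrd, hSel, hDEF⟩ := hPG W hcm hr0 hρ hT hneg hopt h14
      obtain ⟨w₀, h2Nw, hLWK⟩ := levelTwoWitness_baseChange_of_rat W hT hρ K hIQ hodd hHe hsq1 hsq2 hLW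
      have hNPh := nonPhantom_baseChange_of_levelTwoWitness W hT hρ K hIQ hodd hHe hsq1 hsq2 w₀ h2Nw hLWK
      have hBd : BSDp Wd 2 := hTw Wd hcmd hrd hSel
      exact hG W hcm hr0 hρ hT K hIQ hodd h3 hHe Dt hoptDt hc β ι d₁ hy M₀ hdiv hndiv
        (q3flat hQ2 hQ5R hQ1 W hcm hT hneg K hIQ hodd h3 hHe hsq1 hsq2 hNPh hρ Dt β ι d₁ hy M₀ hdiv hndiv
          (hw Dt) Wd hWd hSel hDEF n d hn hKoly hPn)
        Wd hWd hSel hBd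
    · exact hres W hcm hr0 hρ hT hopt (Or.inr (Or.inl ⟨hneg, h14⟩))
  · by_cases h14 : Nat.card (W.selmerGroup 2) = 1 ∨ (Nat.card (W.selmerGroup 2) = 4 ∧
        ∃ c ∈ (W.kummerSelmerStructure ((2 : ℕ) : ℤ)).selmerGroup,
          Literature.NumberTheory.GaloisRepresentations.galoisCohomology.localization (W.torsionGaloisModule ((2 : ℕ) : ℤ))
            (Sum.inl Rat.infinitePlace) 1 c ≠ 0)
    · obtain ⟨K, _, _, hIQ, hodd, h3, hHe, hsq1, hsq2, Dt, β, ι, d₁, hoptDt, hc, hy, M₀, hdiv, hndiv,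
        n, d, hn, hKoly, hPn, Wd, _, _, hWd, hcmd, hrd, hSel, hTam⟩ := hP W hcm hr0 hρ hT hpos hopt h14
      obtain ⟨w₀, h2Nw, hLWK⟩ := levelTwoWitness_baseChange_of_rat W hT hρ K hIQ hodd hHe hsq1 hsq2 hLW
      have hNPh := nonPhantom_baseChange_of_levelTwoWitness W hT hρ K hIQ hodd hHe hsq1 hsq2 w₀ h2Nw hLWK
      have hBd : BSDp Wd 2 := hTw Wd hcmd hrd hSel
      exact hG W hcm hr0 hρ hT K hIQ hodd h3 hHe Dt hoptDt hc β ι d₁ hy M₀ hdiv hndiv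
        (q4flat hQ2 W hcm hT hpos K hIQ hodd h3 hHe hsq1 hsq2 hNPh hρ Dt β ι d₁ hy M₀ hdiv hndiv (hw Dt) Wd hWd hSel hTam
          n d hn hKoly hPn)
        Wd hWd hSel hBd
    · exact hres W hcm hr0 hρ hT hopt (Or.inr (Or.inr ⟨hpos, h14⟩))

end Summit.BirchSwinnertonDyer.BirchSwinnertonDyer.Theorems.GenusExact.Lw2PhantomExclusion
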